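import Summits.BirchSwinnertonDyer.Rank1Residual.Additive.X3BranchLowerEndState
import Summits.BirchSwinnertonDyer.Rank1Residual.AdditivePotMult.CyclotomicThreeOfHalf
import Literature.NumberTheory.EllipticCurves.Wuthrich2014.ReducibleDivisibilityCyclotomicPrimeComponentOfHalf
import HarnessLib

/-!
# X3 on the semistable-twist locus, rank `0`: the END STATE of `X3BranchLowerEndState.lean` over ONE
# typed reading of Wuthrich 2014 Thm. 16 (cell `b2b-bsdres`, team n1011, seat p12 (gen 2), OWNERS row
# T-c2x3 (v); hygiene sequel per referee rulings R118.3 / R119.2 "new consumers take the general fact")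

HONEST FRAMING (cell `b2b-bsdres`, run/shared/lean/b2b/bsd-rank1-residual/, verbatim in every
file): the goal of the cell is to DELETE the COMBINATION-SHAPED residual classes of the
Birch–Swinnerton-Dyer formula for ALL analytic-rank `≤ 1` elliptic curves over `ℚ` — "full BSD
formula for every rank `≤ 1` curve in class `C`" assembled STRICTLY from published theorems — so
that the rank-`≤ 1` remainder becomes exactly the CONSTRUCTION-SHAPED classes, which are TYPED
(missing-input `Prop`s), NOT attempted. This is not "finishing BSD". Team n1011 (RESIDUAL-MAP §I
N10 / N11, X3 = additive `p`, `E[p]` REDUCIBLE), seat `b2b-bsdres-n1011-p12` (gen 2), row T-c2x3 (v):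
research route on the CONSTRUCTION-SHAPED class X3; labels and marks UNCHANGED; nothing booked; NO
Literature fact minted. THEOREMS ONLY.

## What and why

The X3♯(G-ord) consumers of `X3BranchLowerEndState.lean` carry Wuthrich 2014 Thm. 16 through TWO of
its typed readings at once — the general half-eigenspace reading
`Wuthrich2014.thm16_halfEigenCharIdeal_dvd_cyclotomicPrime` (`hW16`, the one the branch conjectures of
row T-c2x3 are typed against) for "Greenberg–Vatsal on the branch ⟹ branch main conjecture", and,
for the UPPER half, the component reading `Wuthrich2014.charIdeal_dvd_padicLFunctionBranch_component`
(`hWu`, `p ≥ 5` rows) or the minus-eigenspace reading at `3`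
`Wuthrich2014.thm16_minusEigenCharIdeal_dvd_cyclotomicThree` (`hW16m`, `p = 3` rows; a def RETIRED as
a separate named fact by referee rulings R118.3 / R119.2). Both are KERNEL CONSEQUENCES of the general
reading in the tree (`Wuthrich2014.charIdeal_dvd_padicLFunctionBranch_component_of_half`;
additive-p1's `AdditivePotMult.thm16_minusEigenCharIdeal_dvd_cyclotomicThree_of_half`), so here every
X3♯(G-ord) end-state theorem is restated over the ONE general reading `hW16`:

* `ClassX3Gord.bsdp_rankZero_of_forall_x3BranchMainConjecture_of_nonAnomalous_of_thm16`,
  `ClassX3Gord.bsdp_rankZero_of_forall_x3BranchLambdaEq_of_muZero_of_nonAnomalous_of_thm16`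
  (`p ≥ 5`, non-CM, non-anomalous);
* `ClassX3Gord.bsdp_three_rankZero_of_forall_x3BranchMainConjecture_of_nonAnomalous_of_thm16`,
  `ClassX3Gord.bsdp_three_rankZero_of_forall_x3BranchLambdaEq_of_muZero_of_nonAnomalous_of_thm16`
  (`p = 3`, non-CM, non-anomalous).

So, uniformly with the X3♯(M) forms (which already use `hW16` only): on X3 ∩ SubSemistableTwist ∧
`r_an = 0`, off the anomalous / CM rows of X3♯(G-ord), `BSD(E,p)` ⟸ ONE typed reading of Wuthrich
2014 Thm. 16 ∧ Delbourgo 1998 Prop. 4 ∧ Delbourgo 2002 (Theorem (B), resp. its `p = 3` form) ∧ Pal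
2012 (even branch) ∧ GZK ∧ modularity — all PUBLISHED — ∧ Greenberg–Vatsal ON THE BRANCH (TYPED,
OPEN) ∧ one analytic `μ`-certificate per pair. Nothing booked; X3 stays CONSTRUCTION-SHAPED.

References: [Wuthrich2014] Thm. 16, §3, §5, Cor. 18; [GreenbergVatsal2000] Thm. (1.3), p. 4;
[Delbourgo2002] Theorems (A), (B) (p. 40); [Delbourgo1998] Prop. 4; [Pal2012] Thm. 3.2.
-/

noncomputable section

open scoped Classical MatrixGroups ModularForm

namespace Summit.BirchSwinnertonDyer.Rank1Residual.Additive

open CongruenceSubgroup WeierstrassCurve Literature.NumberTheory.EllipticCurves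
  Literature.NumberTheory.EllipticCurves.ModularForms
  Literature.NumberTheory.EllipticCurves.Rank1Residual
  Literature.NumberTheory.EllipticCurves.Rank1Residual.Typed
  Literature.NumberTheory.GaloisRepresentations
  Summit.BirchSwinnertonDyer.Rank1Residual.AdditivePotMult
  Summit.BirchSwinnertonDyer.Rank1Residual.Additive.X3Branch

variable {W : WeierstrassCurve ℚ} [W.IsElliptic] [W.IsGloballyMinimal] {p : ℕ} [hp : Fact p.Prime]

/-! ### §1 `p ≥ 5`: the component reading derived from the general one -/

/-- **X3♯(G-ord) ∩ `I₀*`, `p ≥ 5`, `r_an = 0`, non-CM, non-anomalous: the branch main conjecture of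
every twist model ⟹ `BSDp W p`, over ONE reading of Wuthrich Thm. 16** (`hW16`; the component
reading of the upper chain is `charIdeal_dvd_padicLFunctionBranch_component_of_half hW16`).
[cite: Wuthrich2014, Thm. 16 (p. 397), Cor. 18 (p. 398)] [cite: Delbourgo2002, Theorem (B) (p. 40)]
[cite: Delbourgo1998, Prop. 4 (p. 144)] [cite: Pal2012, Thm. 3.2] -/
theorem ClassX3Gord.bsdp_rankZero_of_forall_x3BranchMainConjecture_of_nonAnomalous_of_thm16
    (hW16 : Wuthrich2014.thm16_halfEigenCharIdeal_dvd_cyclotomicPrime)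
    (hPal : Pal2012.thm32_sqrt_mul_realPeriodRat_twist_eq_of_prime_one_mod_four)
    (hDel98 : Delbourgo1998.prop4_rankZero_pow_dvd_constantCoeff) (hDel : Delbourgo2002.mainTheorem)
    (hGZK : rank_eq_analyticRank_of_analyticRank_le_one) (hmod : hasEntireLFunction_rat)
    (hmodD : nonempty_modularParametrizationData)
    (hX : ClassX3Gord W p) (hcm : ¬ W.HasCM) (hp5 : 5 ≤ p) (he : semistabilityIndex W p = 2)
    (hr : W.analyticRank = 0) (hna : Delbourgo2002.ReductionNonAnomalous W p)
    (hMC : ∀ (V : WeierstrassCurve ℚ) [V.IsElliptic] [V.IsGloballyMinimal],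
      (∃ C : VariableChange ℚ, C • V.quadraticTwist ((-1) ^ (p / 2) * p : ℚ) = W) →
        X3BranchMainConjectureAt V p) :
    BSDp W p :=
  ClassX3Gord.bsdp_rankZero_of_forall_x3BranchMainConjecture_of_nonAnomalous
    (Wuthrich2014.charIdeal_dvd_padicLFunctionBranch_component_of_half hW16) hPal hDel98 hDel hGZK hmod
    hmodD hX hcm hp5 he hr hna hMC

/-- **THE ROW'S CONSUMER on X3♯(G-ord) ∩ `I₀*`, `p ≥ 5`, `r_an = 0`, non-CM, non-anomalous, over ONE
reading of Wuthrich Thm. 16**: `hW16` ∧ Greenberg–Vatsal ON THE BRANCH for every twist model (TYPED,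
OPEN) ∧ the analytic `μ`-certificate for every twist model ⟹ `BSDp W p`, everything else PUBLISHED.
[cite: GreenbergVatsal2000, Thm. (1.3) and p. 4] [cite: Wuthrich2014, Thm. 16 (p. 397)]
[cite: Delbourgo2002, Theorem (B) (p. 40)] [cite: Delbourgo1998, Prop. 4 (p. 144)] -/
theorem ClassX3Gord.bsdp_rankZero_of_forall_x3BranchLambdaEq_of_muZero_of_nonAnomalous_of_thm16
    (hW16 : Wuthrich2014.thm16_halfEigenCharIdeal_dvd_cyclotomicPrime)
    (hPal : Pal2012.thm32_sqrt_mul_realPeriodRat_twist_eq_of_prime_one_mod_four)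
    (hDel98 : Delbourgo1998.prop4_rankZero_pow_dvd_constantCoeff) (hDel : Delbourgo2002.mainTheorem)
    (hGZK : rank_eq_analyticRank_of_analyticRank_le_one) (hmod : hasEntireLFunction_rat)
    (hmodD : nonempty_modularParametrizationData)
    (hX : ClassX3Gord W p) (hcm : ¬ W.HasCM) (hp5 : 5 ≤ p) (he : semistabilityIndex W p = 2)
    (hr : W.analyticRank = 0) (hna : Delbourgo2002.ReductionNonAnomalous W p)
    (hlam : ∀ (V : WeierstrassCurve ℚ) [V.IsElliptic] [V.IsGloballyMinimal],
      (∃ C : VariableChange ℚ, C • V.quadraticTwist ((-1) ^ (p / 2) * p : ℚ) = W) →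
        X3BranchLambdaEqAt V p)
    (hμ : ∀ (V : WeierstrassCurve ℚ) [V.IsElliptic] [V.IsGloballyMinimal],
      (∃ C : VariableChange ℚ, C • V.quadraticTwist ((-1) ^ (p / 2) * p : ℚ) = W) →
        X3BranchAnalyticMuZeroAt V p) :
    BSDp W p :=
  ClassX3Gord.bsdp_rankZero_of_forall_x3BranchLambdaEq_of_muZero_of_nonAnomalous hW16
    (Wuthrich2014.charIdeal_dvd_padicLFunctionBranch_component_of_half hW16) hPal hDel98 hDel hGZK hmod
    hmodD hX hcm hp5 he hr hna hlam hμ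

/-! ### §2 `p = 3`: the minus-eigenspace reading at `3` derived from the general one -/

/-- **X3♯(G-ord) at `3`, `r_an = 0`, non-CM, non-anomalous: the `ω`-branch main conjecture of every
twist model ⟹ `BSDp W 3`, over ONE reading of Wuthrich Thm. 16** (`hW16`; the minus-eigen reading at
`3` of the upper chain is additive-p1's `thm16_minusEigenCharIdeal_dvd_cyclotomicThree_of_half hW16`).
[cite: Wuthrich2014, Thm. 16 (p. 397)] [cite: Delbourgo2002, Theorem (A), (B) (p. 40)]
[cite: Delbourgo1998, Prop. 4 (p. 144)] -/
theorem ClassX3Gord.bsdp_three_rankZero_of_forall_x3BranchMainConjecture_of_nonAnomalous_of_thm16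
    [Fact (Nat.Prime 3)] (hW16 : Wuthrich2014.thm16_halfEigenCharIdeal_dvd_cyclotomicPrime)
    (hDel3 : Delbourgo2002.mainTheorem_three)
    (hDel : Delbourgo1998.prop4_rankZero_pow_dvd_constantCoeff)
    (hGZK : rank_eq_analyticRank_of_analyticRank_le_one) (hmod : hasEntireLFunction_rat)
    (hmodD : nonempty_modularParametrizationData)
    (hX : ClassX3Gord W 3) (hcm : ¬ W.HasCM) (hr : W.analyticRank = 0)
    (hna : Delbourgo2002.ReductionNonAnomalous W 3)
    (hMC : ∀ (V : WeierstrassCurve ℚ) [V.IsElliptic] [V.IsGloballyMinimal],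
      (∃ C : VariableChange ℚ, C • V.quadraticTwist (-3 : ℚ) = W) → X3BranchMainConjectureAt V 3) :
    BSDp W 3 :=
  ClassX3Gord.bsdp_three_rankZero_of_forall_x3BranchMainConjecture_of_nonAnomalous hDel3
    (thm16_minusEigenCharIdeal_dvd_cyclotomicThree_of_half hW16) hDel hGZK hmod hmodD hX hcm hr hna hMC

/-- **THE ROW'S CONSUMER on X3♯(G-ord) at `3`, `r_an = 0`, non-CM, non-anomalous, over ONE reading
of Wuthrich Thm. 16**: `hW16` ∧ Greenberg–Vatsal ON THE `ω`-BRANCH for every twist model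
`E ⊗ χ_{−3}` (TYPED, OPEN) ∧ the analytic `μ`-certificate for every twist model ⟹ `BSDp W 3`,
everything else PUBLISHED (`hDel3 hDel hGZK hmod hmodD`).
[cite: GreenbergVatsal2000, Thm. (1.3) and p. 4] [cite: Wuthrich2014, Thm. 16 (p. 397)]
[cite: Delbourgo2002, Theorem (A), (B) (p. 40)] [cite: Delbourgo1998, Prop. 4 (p. 144)] -/
theorem ClassX3Gord.bsdp_three_rankZero_of_forall_x3BranchLambdaEq_of_muZero_of_nonAnomalous_of_thm16
    [Fact (Nat.Prime 3)] (hW16 : Wuthrich2014.thm16_halfEigenCharIdeal_dvd_cyclotomicPrime)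
    (hDel3 : Delbourgo2002.mainTheorem_three)
    (hDel : Delbourgo1998.prop4_rankZero_pow_dvd_constantCoeff)
    (hGZK : rank_eq_analyticRank_of_analyticRank_le_one) (hmod : hasEntireLFunction_rat)
    (hmodD : nonempty_modularParametrizationData)
    (hX : ClassX3Gord W 3) (hcm : ¬ W.HasCM) (hr : W.analyticRank = 0)
    (hna : Delbourgo2002.ReductionNonAnomalous W 3)
    (hlam : ∀ (V : WeierstrassCurve ℚ) [V.IsElliptic] [V.IsGloballyMinimal],
      (∃ C : VariableChange ℚ, C • V.quadraticTwist (-3 : ℚ) = W) → X3BranchLambdaEqAt V 3)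
    (hμ : ∀ (V : WeierstrassCurve ℚ) [V.IsElliptic] [V.IsGloballyMinimal],
      (∃ C : VariableChange ℚ, C • V.quadraticTwist (-3 : ℚ) = W) → X3BranchAnalyticMuZeroAt V 3) :
    BSDp W 3 :=
  ClassX3Gord.bsdp_three_rankZero_of_forall_x3BranchLambdaEq_of_muZero_of_nonAnomalous hW16 hDel3
    (thm16_minusEigenCharIdeal_dvd_cyclotomicThree_of_half hW16) hDel hGZK hmod hmodD hX hcm hr hna hlam
    hμ

end Summit.BirchSwinnertonDyer.Rank1Residual.Additive

end
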